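import Mathlib
import Summits.Schanuel.Schanuel.Theses.RigidCore
import Summits.Schanuel.Schanuel.Theorems.AclSubsetLogFreeCore.Negative.ExpAclField
import Summits.Schanuel.Schanuel.Theorems.AclSubsetLogFreeCore.Negative.AclSubsetLogFreeCoreIffReal
import Summits.Schanuel.Schanuel.Theorems.AclSubsetLogFreeCore.Negative.BranchParity
import Summits.Schanuel.Schanuel.Theorems.AclSubsetLogFreeCore.Negative.LogFreeCoreCountable
import Summits.Schanuel.Schanuel.Theorems.AclSubsetLogFreeCore.Negative.CoreAutWild
import Summits.Schanuel.Schanuel.Theorems.RigidCoreAclSubsetLogFreeCoreOfEac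
import Literature.ModelTheory.ExponentialFields.DefinabilityParams

/-!
# Crux `AclSubsetLogFreeCore` — the hub `ln 2 ∈ dcl^{ℂ_exp}(∅)` (cdisprove gen 4, part 1)

Negative / calibration lemmas for crux stmt-Schanuel-0968,
(A) `acl^{ℂ_exp}(∅) ⊆ C_EA` (`Summit.Schanuel.Schanuel.Theses.RigidCore.AclSubsetLogFreeCore`;
`Negative.aclSubsetLogFreeCore_iff : (A) ↔ expAcl ⊆ logFreeCore`).  Everything is sorry-free.

The single instance of (A) at the branch set `T₂ = {z | e^z = 2} = ln 2 + 2πiℤ` already has the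
shape of the whole problem, and both of its halves are open.  This file makes that precise; the
companion `LogTwoBranchRelations.lean` feeds the hub from accidental algebraic relations.

* §1–§3 **Conjugation averaging.**  A finite non-empty `∅`-definable `F ⊆ T₂` is `conj`-stable, so
  `Σ F = |F|·ln 2` and `ln 2 = Σ F/|F|` is a pointwise `∅`-definable number
  (`log_two_mem_expDcl_of_finite_definable_subset`).  Hence
  **`T₂ ∩ acl(∅) ≠ ∅ ⟺ ln 2 ∈ dcl(∅) ⟺ ln 2 ∈ acl(∅)`**
  (`log_two_mem_expDcl_iff_exists_branch_mem_expAcl`, `branch_mem_expAcl_iff`): for the real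
  logarithm of `2`, `∅`-algebraic = `∅`-definable, and EVERY branch is `∅`-algebraic as soon as one is.
* §4 **(A) at `T₂`** is the implication `ln 2 ∈ dcl(∅) → ln 2 ∈ C_EA`
  (`aclSubsetLogFreeCore_at_branches_iff`); so (A) gives the dichotomy
  `ln 2 ∈ C_EA ∨ T₂ ∩ acl(∅) = ∅` (`logFree_or_branches_disjoint_acl_of_crux`).  The first alternative
  is false under Schanuel's conjecture (`C_EA = K_ω` is the free EA-closure of `ℚ(2πi)`); the second
  says that no parameter-free first-order formula cuts a finite non-empty piece out of the branches of
  `log 2` (the parity class CAN be cut out: `Negative.not_branchIndiscernibility`).  Neither is provable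
  or refutable today.
* §5 **What a refutation of (A) must do, given EAC.**  `¬(A)` produces a pointwise `∅`-definable real
  outside `C_EA` (`exists_real_mem_expDcl_not_mem_of_not`); under Zilber's exponential-algebraic
  closedness it lies in `ecl ∅` (landed stub `stub_aclSubsetEcl_of_eac` of line
  `eac-extends-core-automorphisms`), so **`¬(A) ⇒ ¬EAC ∨ C₀ ⊄ C_EA`** (`not_eac_or_exists_of_not`,
  `not_ecl_subset_logFreeCore_of_not_of_eac`): a refutation of (A) either refutes Zilber's EAC
  conjecture or proves that some exponentially algebraic real number is not log-free — and no explicit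
  complex number is presently provably outside `C_EA = K_ω` (`Negative.CoreAutWild` §4: even
  `C₀ ≠ C_EA` is only SC-true).

## References

* J. Kirby, A. Macintyre, A. Onshuus, *The algebraic numbers definable in various exponential
  fields*, J. Inst. Math. Jussieu 11 (2012) 825–834 (arXiv:1101.4224), §1 (open questions), §2.7.
* M. Bays, J. Kirby, *Pseudo-exponential maps, variants, and quasiminimality*, Algebra & Number
  Theory 12 (2018) 493–549, §9.2, Thm 11.6.
-/

noncomputable section

set_option linter.dupNamespace false

open FirstOrder FirstOrder.Language Set
open Literature.ModelTheory.ExponentialFields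
open Literature.NumberTheory.Transcendental

namespace Summit.Schanuel.Schanuel.Theorems.AclSubsetLogFreeCore.Negative

/-! ## §1 The branch set `T₂` of logarithms of `2` -/

-- Throughout, `T₂` denotes the branch set `{z : ℂ | Complex.exp z = 2} = ln 2 + 2πiℤ` (written out in
-- every statement: no definition, no notation).

/-- `ln 2 ∈ T₂`. [folklore] -/
theorem log_two_mem_logTwoBranches : (Real.log 2 : ℂ) ∈ {z : ℂ | Complex.exp z = 2} := exp_log_two

/-- `T₂ = ln 2 + 2πiℤ`. [folklore] -/
theorem mem_logTwoBranches_iff {z : ℂ} :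
    z ∈ {z : ℂ | Complex.exp z = 2} ↔ ∃ k : ℤ, z = Real.log 2 + k * (2 * Real.pi * Complex.I) := by
  simp only [Set.mem_setOf_eq]
  conv_lhs => rw [← exp_log_two]
  exact Complex.exp_eq_exp_iff_exists_int

/-- `ln 2 + 2πik ∈ T₂`. [folklore] -/
theorem log_two_add_mem_logTwoBranches (k : ℤ) :
    (Real.log 2 : ℂ) + k * (2 * Real.pi * Complex.I) ∈ {z : ℂ | Complex.exp z = 2} :=
  mem_logTwoBranches_iff.2 ⟨k, rfl⟩

/-- Every logarithm of `2` has real part `ln 2`. [folklore] -/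
theorem re_eq_log_two_of_mem {z : ℂ} (hz : z ∈ {z : ℂ | Complex.exp z = 2}) : z.re = Real.log 2 := by
  obtain ⟨k, rfl⟩ := mem_logTwoBranches_iff.1 hz
  simp only [Complex.add_re, Complex.ofReal_re, Complex.mul_re, Complex.mul_im, Complex.intCast_re,
    Complex.intCast_im, Complex.I_re, Complex.I_im, Complex.ofReal_im, Complex.re_ofNat,
    Complex.im_ofNat]
  ring

/-- `T₂` is `∅`-definable (by the quantifier-free formula `e^z = 1 + 1`). [folklore] -/
theorem definable₁_logTwoBranches :
    Set.Definable₁ (∅ : Set ℂ) Language.expRing {z : ℂ | Complex.exp z = 2} := by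
  unfold Set.Definable₁
  simp only [Set.mem_setOf_eq]
  have h2 : (∅ : Set ℂ).DefinableFun Language.expRing (fun _ : Fin 1 → ℂ => (2 : ℂ)) := by
    simpa using definableFun_natCast' (A := (∅ : Set ℂ)) (α := Fin 1) 2
  exact definable_setOf_eq_params (definableFun_cexp (definableFun_proj_params _)) h2

/-- `ln 2 + 2πik ∈ C_EA ⟺ ln 2 ∈ C_EA` (`2πi ∈ C_EA`). -/
theorem branch_mem_logFreeCore_iff (k : ℤ) :
    (Real.log 2 : ℂ) + k * (2 * Real.pi * Complex.I) ∈ logFreeCore ↔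
      (Real.log 2 : ℂ) ∈ logFreeCore := by
  have hk : (k : ℂ) * (2 * Real.pi * Complex.I) ∈ logFreeCore :=
    mul_mem (intCast_mem logFreeCore k) two_pi_I_mem_logFreeCore
  refine ⟨fun h => ?_, fun h => add_mem h hk⟩
  have := sub_mem h hk
  rwa [add_sub_cancel_right] at this

/-! ## §2 Two closure properties of `dcl(∅)` -/

/-- `dcl(∅)` is closed under `c ↦ -c/n` (`n ≥ 1`). [folklore] -/
theorem neg_div_natCast_mem_expDcl {c : ℂ} (hc : c ∈ expDcl) {n : ℕ} (hn : n ≠ 0) :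
    -c / (n : ℂ) ∈ expDcl := by
  have hdef : Set.Definable₁ (∅ : Set ℂ) Language.expRing
      {y : ℂ | ∃ x : ℂ, x ∈ ({c} : Set ℂ) ∧ (n : ℂ) * y + x = 0} := by
    unfold Set.Definable₁
    simp only [Set.mem_setOf_eq]
    refine definable_setOf_exists_params (definable_setOf_and_params ?_ ?_)
    · exact definable_mem_of_definable₁ hc (definableFun_proj_params _)
    · exact definable_setOf_eq_params
        (definableFun_add' (definableFun_mul' (definableFun_natCast' n)
          (definableFun_proj_params _)) (definableFun_proj_params _)) definableFun_zero'
  have hn' : (n : ℂ) ≠ 0 := Nat.cast_ne_zero.2 hn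
  have heq : {y : ℂ | ∃ x : ℂ, x ∈ ({c} : Set ℂ) ∧ (n : ℂ) * y + x = 0} = {-c / (n : ℂ)} := by
    ext y
    simp only [Set.mem_setOf_eq, Set.mem_singleton_iff, exists_eq_left]
    constructor
    · intro h
      field_simp
      linear_combination h
    · rintro rfl
      field_simp
      ring
  show Set.Definable₁ _ _ _
  rw [← heq]
  exact hdef

/-- `dcl(∅)` is closed under `c ↦ e^{c/n}` (`n ≥ 1`). [folklore] -/
theorem exp_div_natCast_mem_expDcl {c : ℂ} (hc : c ∈ expDcl) {n : ℕ} (hn : n ≠ 0) :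
    Complex.exp (c / (n : ℂ)) ∈ expDcl := by
  have hdef : Set.Definable₁ (∅ : Set ℂ) Language.expRing
      {y : ℂ | ∃ u : ℂ, (n : ℂ) * u ∈ ({c} : Set ℂ) ∧ y = Complex.exp u} := by
    unfold Set.Definable₁
    simp only [Set.mem_setOf_eq]
    refine definable_setOf_exists_params (definable_setOf_and_params ?_ ?_)
    · exact definable_mem_of_definable₁ hc
        (definableFun_mul' (definableFun_natCast' n) (definableFun_proj_params _))
    · exact definable_setOf_eq_params (definableFun_proj_params _)
        (definableFun_cexp (definableFun_proj_params _))
  have hn' : (n : ℂ) ≠ 0 := Nat.cast_ne_zero.2 hn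
  have heq : {y : ℂ | ∃ u : ℂ, (n : ℂ) * u ∈ ({c} : Set ℂ) ∧ y = Complex.exp u} =
      {Complex.exp (c / (n : ℂ))} := by
    ext y
    simp only [Set.mem_setOf_eq, Set.mem_singleton_iff]
    constructor
    · rintro ⟨u, hu, rfl⟩
      have : u = c / (n : ℂ) := by
        rw [← hu]; field_simp
      rw [this]
    · rintro rfl
      exact ⟨c / (n : ℂ), by field_simp, rfl⟩
  show Set.Definable₁ _ _ _
  rw [← heq]
  exact hdef

/-! ## §3 Conjugation averaging: `T₂ ∩ acl(∅) ≠ ∅ ⟺ ln 2 ∈ dcl(∅)` -/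

/-- `conj` permutes every finite `∅`-definable set. [folklore] -/
theorem image_conj_toFinset_eq {F : Set ℂ} (hF : F.Finite)
    (hdef : Set.Definable₁ (∅ : Set ℂ) Language.expRing F) :
    hF.toFinset.image (starRingEnd ℂ) = hF.toFinset := by
  apply Finset.eq_of_subset_of_card_le
  · intro y hy
    obtain ⟨x, hx, rfl⟩ := Finset.mem_image.1 hy
    exact hF.mem_toFinset.2 (conj_mem_of_definable₁ hdef (hF.mem_toFinset.1 hx))
  · rw [Finset.card_image_of_injective _ (starRingEnd ℂ).injective]

/-- The sum of a finite `∅`-definable set is real. [folklore] -/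
theorem sum_im_eq_zero_of_definable {F : Set ℂ} (hF : F.Finite)
    (hdef : Set.Definable₁ (∅ : Set ℂ) Language.expRing F) :
    (∑ y ∈ hF.toFinset, y).im = 0 := by
  have h : ∑ y ∈ hF.toFinset, y = ∑ y ∈ hF.toFinset, (starRingEnd ℂ) y := by
    conv_lhs => rw [← image_conj_toFinset_eq hF hdef]
    rw [Finset.sum_image fun x _ y _ h => (starRingEnd ℂ).injective h]
  have h2 : (∑ y ∈ hF.toFinset, y).im = -(∑ y ∈ hF.toFinset, y).im := by
    conv_lhs => rw [h]
    rw [← map_sum, Complex.conj_im]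
  linarith

/-- **Conjugation averaging.** If a finite non-empty `∅`-definable set consists of logarithms of `2`,
then `ln 2` is pointwise `∅`-definable: the set is `conj`-stable, so its sum is `|F|·ln 2`, and the
sum is (minus) a coefficient of its root polynomial, an `∅`-definable point. -/
theorem log_two_mem_expDcl_of_finite_definable_subset {F : Set ℂ} (hF : F.Finite)
    (hdef : Set.Definable₁ (∅ : Set ℂ) Language.expRing F) (hsub : F ⊆ {z : ℂ | Complex.exp z = 2})
    (hne : F.Nonempty) : (Real.log 2 : ℂ) ∈ expDcl := by
  have hNpos : 0 < hF.toFinset.card :=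
    Finset.card_pos.2 ((Set.Finite.toFinset_nonempty hF).2 hne)
  have hN' : (hF.toFinset.card : ℂ) ≠ 0 := Nat.cast_ne_zero.2 hNpos.ne'
  have hsum : ∑ y ∈ hF.toFinset, y = (hF.toFinset.card : ℂ) * Real.log 2 := by
    apply Complex.ext
    · rw [Complex.re_sum]
      have : ∀ y ∈ hF.toFinset, y.re = Real.log 2 := fun y hy =>
        re_eq_log_two_of_mem (hsub (hF.mem_toFinset.1 hy))
      rw [Finset.sum_congr rfl this, Finset.sum_const, nsmul_eq_mul]
      simp only [Complex.mul_re, Complex.natCast_re, Complex.natCast_im, Complex.ofReal_re,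
        Complex.ofReal_im]
      ring
    · rw [sum_im_eq_zero_of_definable hF hdef]
      simp only [Complex.mul_im, Complex.natCast_re, Complex.natCast_im, Complex.ofReal_re,
        Complex.ofReal_im]
      ring
  have hc : (∏ y ∈ hF.toFinset, (Polynomial.X - Polynomial.C y)).coeff (hF.toFinset.card - 1) =
      -((hF.toFinset.card : ℂ) * Real.log 2) := by
    have h := Polynomial.prod_X_sub_C_coeff_card_pred hF.toFinset (fun y : ℂ => y) hNpos
    rw [h, hsum]
  have hcoeff : -((hF.toFinset.card : ℂ) * Real.log 2) ∈ expDcl :=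
    hc ▸ coeff_mem_expDcl hF hdef _
  have h := neg_div_natCast_mem_expDcl hcoeff hNpos.ne'
  rwa [neg_neg, mul_div_cancel_left₀ _ hN'] at h

/-- **`ln 2 ∈ dcl(∅)` iff SOME branch `ln 2 + 2πik` is `∅`-algebraic** (lies in a finite `∅`-definable
set): intersect that set with `T₂` and average. -/
theorem log_two_mem_expDcl_iff_exists_branch_mem_expAcl :
    (Real.log 2 : ℂ) ∈ expDcl ↔
      ∃ k : ℤ, (Real.log 2 : ℂ) + k * (2 * Real.pi * Complex.I) ∈ expAcl := by
  constructor
  · intro h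
    exact ⟨0, by simpa using expDcl_subset_expAcl h⟩
  · rintro ⟨k, s, hs, hdef, hks⟩
    exact log_two_mem_expDcl_of_finite_definable_subset (F := s ∩ {z : ℂ | Complex.exp z = 2})
      (hs.inter_of_left _) (hdef.inter definable₁_logTwoBranches) Set.inter_subset_right
      ⟨_, hks, log_two_add_mem_logTwoBranches k⟩

/-- For the real logarithm of `2`, `∅`-algebraic = `∅`-definable. -/
theorem log_two_mem_expAcl_iff_mem_expDcl :
    (Real.log 2 : ℂ) ∈ expAcl ↔ (Real.log 2 : ℂ) ∈ expDcl :=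
  ⟨fun h => log_two_mem_expDcl_iff_exists_branch_mem_expAcl.2 ⟨0, by simpa using h⟩,
    fun h => expDcl_subset_expAcl h⟩

/-- Every branch of `log 2` is `∅`-algebraic as soon as `ln 2` is `∅`-definable, and conversely. -/
theorem branch_mem_expAcl_iff (k : ℤ) :
    (Real.log 2 : ℂ) + k * (2 * Real.pi * Complex.I) ∈ expAcl ↔ (Real.log 2 : ℂ) ∈ expDcl := by
  refine ⟨fun h => log_two_mem_expDcl_iff_exists_branch_mem_expAcl.2 ⟨k, h⟩, fun h => ?_⟩
  exact add_mem_expAcl (expDcl_subset_expAcl h)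
    (mul_mem_expAcl (intCast_mem_expAcl k) two_pi_I_mem_expAcl)

/-! ## §4 (A) at the branch set -/

/-- **(A) restricted to `T₂`** is exactly the implication `ln 2 ∈ dcl(∅) → ln 2 ∈ C_EA`. -/
theorem aclSubsetLogFreeCore_at_branches_iff :
    (∀ k : ℤ, (Real.log 2 : ℂ) + k * (2 * Real.pi * Complex.I) ∈ expAcl →
        (Real.log 2 : ℂ) + k * (2 * Real.pi * Complex.I) ∈ logFreeCore) ↔
      ((Real.log 2 : ℂ) ∈ expDcl → (Real.log 2 : ℂ) ∈ logFreeCore) := by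
  constructor
  · intro h hd
    have := h 0 ((branch_mem_expAcl_iff 0).2 hd)
    simpa using this
  · intro h k hk
    exact (branch_mem_logFreeCore_iff k).2 (h ((branch_mem_expAcl_iff k).1 hk))

/-- (A) turns the hub `ln 2 ∈ dcl(∅)` into the SC-false `ln 2 ∈ C_EA`. -/
theorem log_two_mem_logFreeCore_of_crux
    (hA : Summit.Schanuel.Schanuel.Theses.RigidCore.AclSubsetLogFreeCore)
    (h : (Real.log 2 : ℂ) ∈ expDcl) : (Real.log 2 : ℂ) ∈ logFreeCore :=
  aclSubsetLogFreeCore_iff.1 hA (expDcl_subset_expAcl h)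

/-- **Dichotomy.** (A) ⇒ `ln 2 ∈ C_EA` (SC-false) ∨ no branch of `log 2` is `∅`-algebraic
(`T₂ ∩ acl(∅) = ∅`: no parameter-free formula isolates a finite non-empty set of branches). -/
theorem logFree_or_branches_disjoint_acl_of_crux
    (hA : Summit.Schanuel.Schanuel.Theses.RigidCore.AclSubsetLogFreeCore) :
    (Real.log 2 : ℂ) ∈ logFreeCore ∨
      ∀ k : ℤ, (Real.log 2 : ℂ) + k * (2 * Real.pi * Complex.I) ∉ expAcl := by
  by_cases h : (Real.log 2 : ℂ) ∈ expDcl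
  · exact Or.inl (log_two_mem_logFreeCore_of_crux hA h)
  · exact Or.inr fun k hk => h ((branch_mem_expAcl_iff k).1 hk)

/-! ## §5 What a refutation of (A) must do, given EAC -/

/-- A refutation of (A) is a pointwise `∅`-definable real number outside `C_EA`. -/
theorem exists_real_mem_expDcl_not_mem_of_not
    (h : ¬ Summit.Schanuel.Schanuel.Theses.RigidCore.AclSubsetLogFreeCore) :
    ∃ r : ℝ, (r : ℂ) ∈ expDcl ∧ (r : ℂ) ∉ logFreeCore := by
  rw [aclSubsetLogFreeCore_iff_real] at h
  push Not at h
  exact h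

/-- **`¬(A) ⇒ ¬EAC ∨ (some pointwise-definable, exponentially algebraic real is not log-free)`.**
Under Zilber's exponential-algebraic closedness `dcl(∅) ⊆ acl(∅) ⊆ ecl(∅)` (landed stub
`stub_aclSubsetEcl_of_eac`), so the witness of a refutation lies in `C₀ = ecl ∅`. -/
theorem not_eac_or_exists_of_not
    (h : ¬ Summit.Schanuel.Schanuel.Theses.RigidCore.AclSubsetLogFreeCore) :
    ¬ IsExpAlgClosed ℂ ∨
      ∃ r : ℝ, (r : ℂ) ∈ expDcl ∧ (r : ℂ) ∈ ecl (∅ : Set ℂ) ∧ (r : ℂ) ∉ logFreeCore := by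
  by_cases hE : IsExpAlgClosed ℂ
  · obtain ⟨r, hr, hn⟩ := exists_real_mem_expDcl_not_mem_of_not h
    exact Or.inr ⟨r, hr, Summit.Schanuel.Schanuel.Theorems.RigidCore.expDcl_subset_ecl_of_eac hE hr, hn⟩
  · exact Or.inl hE

/-- Equivalently: **a refutation of (A) compatible with EAC proves `C₀ ⊄ C_EA`**, i.e. that some
exponentially algebraic number is not log-free — which no presently known transcendence theorem
provides for any explicit number (`CoreAutWild`: `C₀ ≠ C_EA` is only SC-true). -/
theorem not_ecl_subset_logFreeCore_of_not_of_eac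
    (h : ¬ Summit.Schanuel.Schanuel.Theses.RigidCore.AclSubsetLogFreeCore)
    (hE : IsExpAlgClosed ℂ) : ¬ (ecl (∅ : Set ℂ) ⊆ (logFreeCore : Set ℂ)) := by
  intro hsub
  rcases not_eac_or_exists_of_not h with hne | ⟨r, -, hr, hn⟩
  · exact hne hE
  · exact hn (hsub hr)

end Summit.Schanuel.Schanuel.Theorems.AclSubsetLogFreeCore.Negative
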